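import Mathlib
import Literature.Probability.LatticeModels.GKSInequalities
import Summits.CriticalPhenomena.Ising3DConformalLimit.Theorems.PrecisionLaplacianInverseMFerromagnetRowDegLeTwo
import Summits.CriticalPhenomena.Ising3DConformalLimit.Theorems.PrecisionLaplacianInverseMFerromagnetImNonadjOfLaw2Aux
import HarnessLib

/-!
# Crux `PrecisionLaplacian.InverseMFerromagnet` (stmt-CriticalPhenomena-4798), line `Sketch` —
# stub `helper_cycle_precision` (core D, dividend D2: the precision matrix of a cycle)

THEOREM-ONLY file (no definitions).  Sites `Fin N` (`N ≥ 3`) on a cycle, bond `i = {i, i+1}`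
with coupling `κ_i ≥ 0`, `T = ∏ tanh κ_i`, `Σ = (⟨σ_pσ_q⟩)` the spin second-moment matrix of
`gksExpect univ κ C`.  We prove `Σ⁻¹ = (1+T)/(1−T) · Γ_B` with the Bethe (tree) precision
`(Γ_B)_{xx} = 1 + sinh²κ_{x−1} + sinh²κ_x`, `(Γ_B)_{x,x±1} = −½ sinh 2κ` of the joining bond, `0`
elsewhere (refines the equal-coupling case of Lauritzen–Uhler–Zwiernik 2021, Prop. 5.3).
Proof: (1) degree-two rows — the flip at `x` (`c3_gksExpect_spin_eq_tanh`) and the two-spin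
identity `tanh(κ₁s + κ₂s')(1 + sinh²κ₁ + sinh²κ₂) = ½ sinh 2κ₁ s + ½ sinh 2κ₂ s'` give
`(Γ_B Σ)_{xq} = 0`, `q ≠ x` (`cp_callen`); (2) high-temperature expansion — `∑_ω ∏_{i∈S} σ_iσ_{i+1}`
is `2^N` for `S ∈ {∅, all bonds}` and `0` otherwise, whence `Z = 2^N(∏cosh κ + ∏sinh κ)` and
`Z⟨σ_jσ_{j+1}⟩ = 2^N(sinh κ_j ∏_{i≠j} cosh κ_i + cosh κ_j ∏_{i≠j} sinh κ_i)` (`cp_gksSum_prod`,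
`cp_nn`); (3) `(Γ_B Σ)_{xx} = (1−T)/(1+T)` is then polynomial algebra (`cosh² = 1 + sinh²`), and
`Σ⁻¹ = (1+T)/(1−T) Γ_B` by `Matrix.inv_eq_left_inv`.  The cycle enters through abstract successor /
predecessor maps `nx`, `pv` (`cp_main`), instantiated at the end by `i ↦ (i+1) % N`, `(i+N−1) % N`.
-/

namespace Summit.CriticalPhenomena.Ising3DConformalLimit.Cruxes.InverseMFerromagnet.PartialCovarianceLadder

open Literature.Probability.LatticeModels Finset Matrix
open scoped symmDiff

/-- `tanh (ap + bq) (1 + sinh² a + sinh² b) = sinh a cosh a p + sinh b cosh b q` on `{±1}²`. [folklore] -/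
theorem cp_tanh_two (a b p q : ℝ) (hp : p = 1 ∨ p = -1) (hq : q = 1 ∨ q = -1) :
    Real.tanh (a * p + b * q) * (1 + Real.sinh a ^ 2 + Real.sinh b ^ 2)
      = Real.sinh a * Real.cosh a * p + Real.sinh b * Real.cosh b * q := by
  have key : ∀ u v : ℝ, Real.tanh (u + v) * (1 + Real.sinh u ^ 2 + Real.sinh v ^ 2)
      = Real.sinh u * Real.cosh u + Real.sinh v * Real.cosh v := fun u v => by
    rw [Real.tanh_eq_sinh_div_cosh, div_mul_eq_mul_div, div_eq_iff (Real.cosh_pos _).ne',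
      Real.sinh_add, Real.cosh_add]
    linear_combination (-(Real.sinh u * Real.cosh v)) * Real.cosh_sq u
      + (-(Real.cosh u * Real.sinh v)) * Real.cosh_sq v
  rcases hp with rfl | rfl <;> rcases hq with rfl | rfl <;> simp only [mul_one, mul_neg_one]
  · exact key a b
  · simpa [neg_sq] using key a (-b)
  · simpa [neg_sq] using key (-a) b
  · simpa [neg_sq] using key (-a) (-b)

/-- `a % N` for `a < 2N`. [folklore] -/
theorem cp_mod_cases (a N : ℕ) (h : a < 2 * N) :
    (a % N = a ∧ a < N) ∨ (a % N = a - N ∧ N ≤ a) := by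
  rcases lt_or_ge a N with h1 | h1
  · exact Or.inl ⟨Nat.mod_eq_of_lt h1, h1⟩
  · refine Or.inr ⟨?_, h1⟩
    rw [Nat.mod_eq_sub_mod h1, Nat.mod_eq_of_lt (by omega)]

/-- `pred (succ i) = i` on the cycle `Fin N`. [folklore] -/
theorem cp_idx_pn {N : ℕ} (hN : 3 ≤ N) (i : Fin N) :
    (⟨((i.1 + 1) % N + N - 1) % N, Nat.mod_lt _ (by omega)⟩ : Fin N) = i := Fin.ext (by
  show ((i.1 + 1) % N + N - 1) % N = i.1
  rw [show (i.1 + 1) % N + N - 1 = (i.1 + 1) % N + (N - 1) by omega, Nat.mod_add_mod,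
    show i.1 + 1 + (N - 1) = i.1 + N by omega, Nat.add_mod_right, Nat.mod_eq_of_lt i.2])

/-- `succ (pred i) = i` on the cycle `Fin N`. [folklore] -/
theorem cp_idx_np {N : ℕ} (hN : 3 ≤ N) (i : Fin N) :
    (⟨((i.1 + N - 1) % N + 1) % N, Nat.mod_lt _ (by omega)⟩ : Fin N) = i := Fin.ext (by
  show ((i.1 + N - 1) % N + 1) % N = i.1
  rw [Nat.mod_add_mod, show i.1 + N - 1 + 1 = i.1 + N by omega, Nat.add_mod_right,
    Nat.mod_eq_of_lt i.2])

/-- `succ i ≠ i` on the cycle `Fin N`, `N ≥ 2`. [folklore] -/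
theorem cp_idx_n1 {N : ℕ} (hN : 3 ≤ N) (i : Fin N) :
    (⟨(i.1 + 1) % N, Nat.mod_lt _ (by omega)⟩ : Fin N) ≠ i := fun h => by
  have h' : (i.1 + 1) % N = i.1 := congrArg Fin.val h
  have hi := i.2
  rcases cp_mod_cases (i.1 + 1) N (by omega) with ⟨h1, h2⟩ | ⟨h1, h2⟩ <;> omega

/-- `succ (succ i) ≠ i` on the cycle `Fin N`, `N ≥ 3`. [folklore] -/
theorem cp_idx_n2 {N : ℕ} (hN : 3 ≤ N) (i : Fin N) :
    (⟨((i.1 + 1) % N + 1) % N, Nat.mod_lt _ (by omega)⟩ : Fin N) ≠ i := fun h => by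
  have h' : ((i.1 + 1) % N + 1) % N = i.1 := congrArg Fin.val h
  rw [Nat.mod_add_mod] at h'
  have hi := i.2
  rcases cp_mod_cases (i.1 + 1 + 1) N (by omega) with ⟨h1, h2⟩ | ⟨h1, h2⟩ <;> omega

/-- A forward-invariant set of bonds of the cycle is `∅` or everything. [folklore] -/
theorem cp_idx_orb {N : ℕ} (hN : 3 ≤ N) (S : Finset (Fin N))
    (hS : ∀ i ∈ S, (⟨(i.1 + 1) % N, Nat.mod_lt _ (by omega)⟩ : Fin N) ∈ S) :
    S = ∅ ∨ S = Finset.univ := by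
  rcases S.eq_empty_or_nonempty with h | ⟨i₀, hi₀⟩
  · exact Or.inl h
  · refine Or.inr (Finset.eq_univ_of_forall fun j => ?_)
    have h0 : 0 < N := by omega
    have step : ∀ k : ℕ, (⟨(i₀.1 + k) % N, Nat.mod_lt _ h0⟩ : Fin N) ∈ S := by
      intro k
      induction k with
      | zero => simpa [Nat.mod_eq_of_lt i₀.2] using hi₀
      | succ k ih =>
        have he : (⟨((i₀.1 + k) % N + 1) % N, Nat.mod_lt _ h0⟩ : Fin N)
            = ⟨(i₀.1 + (k + 1)) % N, Nat.mod_lt _ h0⟩ :=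
          Fin.ext (by simp only [Nat.mod_add_mod, add_assoc])
        exact he ▸ hS _ ih
    have he : (⟨(i₀.1 + (j.1 + N - i₀.1)) % N, Nat.mod_lt _ h0⟩ : Fin N) = j := Fin.ext (by
      show (i₀.1 + (j.1 + N - i₀.1)) % N = j.1
      rw [show i₀.1 + (j.1 + N - i₀.1) = j.1 + N by omega, Nat.add_mod_right, Nat.mod_eq_of_lt j.2])
    exact he ▸ step (j.1 + N - i₀.1)

/-- `∑_ω σ_B(ω) = 0` for `B ≠ ∅` (flip one spin of `B`). [folklore] -/
theorem cp_sum_spinProduct {N : ℕ} {B : Finset (Fin N)} (hB : B.Nonempty) :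
    ∑ ω : SpinConfig (Fin N), spinProduct B ω = 0 := by
  obtain ⟨v, hv⟩ := hB
  have h : ∀ ω' : SpinConfig (Fin N),
      spinProduct B ω' = spinAt v ω' * ∏ x ∈ B.erase v, spinAt x ω' :=
    fun ω' => (Finset.mul_prod_erase B (fun x => spinAt x ω') hv).symm
  refine c2_sum_flip_zero v _ fun ω => ?_
  rw [h, h, pcm2im_spinAt_flip_same,
    Finset.prod_congr rfl fun x hx => pcm2im_spinAt_flip_ne (Finset.ne_of_mem_erase hx) ω]
  ring

/-- `∑_ω (∏_{i∈A} σ_iσ_{i+1})(∏_{i∈S} σ_iσ_{i+1})` is `2^N` for `S ∈ {A, Aᶜ}` and `0` otherwise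
(`∏_{i∈T} σ_iσ_{i+1} = σ_{T ∆ (T+1)}`, and `T + 1 = T` only for `T ∈ {∅, all bonds}`). [folklore] -/
theorem cp_sum_prod_pair {N : ℕ} (nx pv : Fin N → Fin N) (hpn : ∀ i, pv (nx i) = i)
    (hn1 : ∀ i, nx i ≠ i)
    (horb : ∀ S : Finset (Fin N), (∀ i ∈ S, nx i ∈ S) → S = ∅ ∨ S = Finset.univ)
    (A S : Finset (Fin N)) :
    ∑ ω : SpinConfig (Fin N), (∏ i ∈ A, spinProduct ({i, nx i} : Finset (Fin N)) ω)
        * ∏ i ∈ S, spinProduct ({i, nx i} : Finset (Fin N)) ω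
      = if S = A ∨ S = univ \ A then (Fintype.card (SpinConfig (Fin N)) : ℝ) else 0 := by
  have hinj : Function.Injective nx := fun a b h => by rw [← hpn a, h, hpn]
  have hprod : ∀ (T : Finset (Fin N)) (ω : SpinConfig (Fin N)),
      ∏ i ∈ T, spinProduct ({i, nx i} : Finset (Fin N)) ω = spinProduct (T ∆ T.image nx) ω := by
    intro T ω
    rw [← spinProduct_mul_eq_spinProduct_symmDiff, spinProduct, spinProduct,
      Finset.prod_image hinj.injOn, ← Finset.prod_mul_distrib]
    exact Finset.prod_congr rfl fun i _ => c2_spinProduct_pair (hn1 i).symm ω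
  have hset : (A ∆ A.image nx) ∆ (S ∆ S.image nx) = (S ∆ A) ∆ (S ∆ A).image nx := by
    rw [Finset.image_symmDiff _ _ hinj, symmDiff_symmDiff_symmDiff_comm, symmDiff_comm A S,
      symmDiff_comm (A.image nx)]
  have hiff : (S ∆ A = ∅ ∨ S ∆ A = univ) ↔ (S = A ∨ S = univ \ A) := by
    rw [Finset.symmDiff_eq_empty, ← Finset.top_eq_univ, symmDiff_eq_top, ← eq_compl_iff_isCompl,
      Finset.compl_eq_univ_sdiff, Finset.top_eq_univ]
  have huniv : (Finset.univ : Finset (Fin N)).image nx = Finset.univ :=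
    Finset.eq_univ_of_card _ (by rw [Finset.card_image_of_injective _ hinj, Finset.card_univ])
  simp_rw [hprod, spinProduct_mul_eq_spinProduct_symmDiff, hset]
  generalize S ∆ A = T at hiff ⊢
  by_cases h : T = T.image nx
  · have hT : T = ∅ ∨ T = univ :=
      horb T fun i hi => by rw [h]; exact Finset.mem_image_of_mem nx hi
    rw [← h, symmDiff_self, Finset.bot_eq_empty, if_pos (hiff.1 hT)]
    simp
  · rw [cp_sum_spinProduct (Finset.symmDiff_nonempty.2 h), if_neg]
    intro h'
    rcases hiff.2 h' with rfl | rfl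
    · exact h (by simp)
    · exact h huniv.symm

/-- **High-temperature expansion on the cycle.**  For a set `A` of bonds,
`∑_ω (∏_{i∈A} σ_iσ_{i+1}) e^{H} = 2^N ((∏_A sinh κ)(∏_{Aᶜ} cosh κ) + (∏_{Aᶜ} sinh κ)(∏_A cosh κ))`:
in the expansion over bond sets `S` only `S = A` and `S = Aᶜ` survive. [folklore] -/
theorem cp_gksSum_prod {N : ℕ} (hN : 0 < N) (nx pv : Fin N → Fin N)
    (hpn : ∀ i, pv (nx i) = i) (hn1 : ∀ i, nx i ≠ i)
    (horb : ∀ S : Finset (Fin N), (∀ i ∈ S, nx i ∈ S) → S = ∅ ∨ S = Finset.univ)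
    (κ : Fin N → ℝ) (A : Finset (Fin N)) :
    gksSum Finset.univ κ (fun i => ({i, nx i} : Finset (Fin N)))
        (fun ω => ∏ i ∈ A, spinProduct ({i, nx i} : Finset (Fin N)) ω)
      = (Fintype.card (SpinConfig (Fin N)) : ℝ) *
        ((∏ i ∈ A, Real.sinh (κ i)) * (∏ i ∈ univ \ A, Real.cosh (κ i))
          + (∏ i ∈ univ \ A, Real.sinh (κ i)) * (∏ i ∈ A, Real.cosh (κ i))) := by
  have hAne : A ≠ univ \ A := fun h => by
    have h1 := Finset.ext_iff.1 h ⟨0, hN⟩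
    simp only [Finset.mem_sdiff, Finset.mem_univ, true_and] at h1
    exact iff_not_self h1
  unfold gksSum
  simp_rw [gksWeight_eq_sum_powerset, Finset.mul_sum]
  rw [Finset.sum_comm]
  have hterm : ∀ (S : Finset (Fin N)) (ω : SpinConfig (Fin N)),
      (∏ i ∈ A, spinProduct ({i, nx i} : Finset (Fin N)) ω) *
        (((∏ i ∈ S, Real.sinh (κ i)) * ∏ i ∈ univ \ S, Real.cosh (κ i)) *
          ∏ i ∈ S, spinProduct ({i, nx i} : Finset (Fin N)) ω)
      = ((∏ i ∈ S, Real.sinh (κ i)) * ∏ i ∈ univ \ S, Real.cosh (κ i)) *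
          ((∏ i ∈ A, spinProduct ({i, nx i} : Finset (Fin N)) ω)
            * ∏ i ∈ S, spinProduct ({i, nx i} : Finset (Fin N)) ω) := fun S ω => by ring
  simp_rw [hterm, ← Finset.mul_sum, cp_sum_prod_pair nx pv hpn hn1 horb A, mul_ite, mul_zero]
  rw [Finset.sum_eq_add_of_mem A (univ \ A) (Finset.mem_powerset.2 (Finset.subset_univ _))
    (Finset.mem_powerset.2 (Finset.subset_univ _)) hAne (fun S _ h => if_neg (not_or.2 h)),
    if_pos (Or.inl rfl), if_pos (Or.inr rfl), Finset.sdiff_sdiff_self_left, Finset.univ_inter]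
  ring

/-- **Nearest-neighbour correlations of the cycle**:
`⟨σ_jσ_{j+1}⟩ = (sinh κ_j ∏_{i≠j} cosh κ_i + cosh κ_j ∏_{i≠j} sinh κ_i)/(∏ cosh κ + ∏ sinh κ)`
(`= (t_j + ∏_{i≠j} t_i)/(1 + T)`). [folklore] -/
theorem cp_nn {N : ℕ} (hN : 0 < N) (nx pv : Fin N → Fin N) (hpn : ∀ i, pv (nx i) = i)
    (hn1 : ∀ i, nx i ≠ i)
    (horb : ∀ S : Finset (Fin N), (∀ i ∈ S, nx i ∈ S) → S = ∅ ∨ S = Finset.univ)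
    (κ : Fin N → ℝ) (j : Fin N) :
    gksExpect Finset.univ κ (fun i => ({i, nx i} : Finset (Fin N)))
        (fun ω => spinAt j ω * spinAt (nx j) ω)
      = (Real.sinh (κ j) * ∏ i ∈ univ.erase j, Real.cosh (κ i)
          + (∏ i ∈ univ.erase j, Real.sinh (κ i)) * Real.cosh (κ j))
        / (∏ i, Real.cosh (κ i) + ∏ i, Real.sinh (κ i)) := by
  have hcard : (0 : ℝ) < Fintype.card (SpinConfig (Fin N)) := by exact_mod_cast Fintype.card_pos
  have h1 := cp_gksSum_prod hN nx pv hpn hn1 horb κ {j}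
  have h0 := cp_gksSum_prod hN nx pv hpn hn1 horb κ ∅
  simp only [Finset.prod_singleton, Finset.sdiff_singleton_eq_erase] at h1
  simp only [Finset.prod_empty, Finset.sdiff_empty, one_mul, mul_one] at h0
  have hint : (fun ω => spinAt j ω * spinAt (nx j) ω)
      = fun ω => spinProduct ({j, nx j} : Finset (Fin N)) ω :=
    funext fun ω => (c2_spinProduct_pair (hn1 j).symm ω).symm
  unfold gksExpect
  rw [hint, h1, h0, mul_div_mul_left _ _ hcard.ne']

/-- **The degree-two row at `x` (Callen identity, explicit form).**  For `F` invariant under the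
flip at `x`:
`(1 + sinh²κ_{x−1} + sinh²κ_x)⟨σ_x F⟩ = ½ sinh 2κ_{x−1} ⟨σ_{x−1}F⟩ + ½ sinh 2κ_x ⟨σ_{x+1}F⟩`. [folklore] -/
theorem cp_callen {N : ℕ} (nx pv : Fin N → Fin N) (hpn : ∀ i, pv (nx i) = i)
    (hnp : ∀ i, nx (pv i) = i) (hn1 : ∀ i, nx i ≠ i) (κ : Fin N → ℝ) (x : Fin N)
    (F : SpinConfig (Fin N) → ℝ) (hF : ∀ ω, F (ω * Pi.mulSingle x (-1)) = F ω) :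
    (1 + Real.sinh (κ (pv x)) ^ 2 + Real.sinh (κ x) ^ 2) *
        gksExpect Finset.univ κ (fun i => ({i, nx i} : Finset (Fin N)))
          (fun ω => spinAt x ω * F ω)
      = Real.sinh (κ (pv x)) * Real.cosh (κ (pv x)) *
          gksExpect Finset.univ κ (fun i => ({i, nx i} : Finset (Fin N)))
            (fun ω => spinAt (pv x) ω * F ω)
        + Real.sinh (κ x) * Real.cosh (κ x) *
          gksExpect Finset.univ κ (fun i => ({i, nx i} : Finset (Fin N)))
            (fun ω => spinAt (nx x) ω * F ω) := by
  have hpx : pv x ≠ x := fun h => hn1 x (by have := hnp x; rwa [h] at this)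
  have hφ : ∀ (ω : SpinConfig (Fin N)) (r : Fin N),
      (ω * Pi.mulSingle x (-1) : SpinConfig (Fin N)) r = if r = x then -ω r else ω r := by
    intro ω r
    rw [Pi.mul_apply]
    by_cases h : r = x
    · subst h; simp
    · simp [h]
  have hI : ∀ i, i ∈ ({pv x, x} : Finset (Fin N)) ↔
      x ∈ (fun i => ({i, nx i} : Finset (Fin N))) i := fun i => by
    simp only [Finset.mem_insert, Finset.mem_singleton]
    constructor
    · rintro (rfl | rfl)
      exacts [Or.inr (hnp x).symm, Or.inl rfl]
    · rintro (rfl | h)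
      exacts [Or.inr rfl, Or.inl (by rw [h, hpn])]
  have hu : ∀ i, x ∈ (fun i => ({i, nx i} : Finset (Fin N))) i →
      (fun i => ({i, nx i} : Finset (Fin N))) i = {x, if i = x then nx x else pv x} := by
    intro i hi
    obtain rfl | rfl : i = pv x ∨ i = x := by simpa using (hI i).2 hi
    · show ({pv x, nx (pv x)} : Finset (Fin N)) = _
      rw [if_neg hpx, hnp, Finset.pair_comm]
    · exact congrArg _ (congrArg _ (if_pos rfl).symm)
  have huz : ∀ i, (if i = x then nx x else pv x) ≠ x := fun i => by
    split_ifs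
    exacts [hn1 x, hpx]
  rw [c3_gksExpect_spin_eq_tanh κ (fun i => ({i, nx i} : Finset (Fin N))) x
    (fun ω => ω * Pi.mulSingle x (-1)) hφ {pv x, x} hI (fun i => if i = x then nx x else pv x)
    hu huz F hF]
  simp only [Finset.sum_pair hpx, if_true, if_neg hpx]
  rw [← pcm2im_gksExpect_const_mul, ← pcm2im_gksExpect_const_mul,
    ← pcm2im_gksExpect_const_mul, ← pcm2im_gksExpect_add]
  congr 1
  funext ω
  linear_combination F ω * cp_tanh_two (κ (pv x)) (κ x) (spinAt (pv x) ω) (spinAt (nx x) ω)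
    (spinAt_eq_one_or_eq_neg_one _ _) (spinAt_eq_one_or_eq_neg_one _ _)

/-- Row `p` of the Bethe precision against a vector: only `p`, `p+1`, `p−1` contribute. [folklore] -/
theorem cp_row_sum {N : ℕ} (nx pv : Fin N → Fin N) (hpn : ∀ i, pv (nx i) = i)
    (hnp : ∀ i, nx (pv i) = i) (hn1 : ∀ i, nx i ≠ i) (hn2 : ∀ i, nx (nx i) ≠ i) (p : Fin N)
    (d a b f : Fin N → ℝ) :
    ∑ r, (if p = r then d r else if r = nx p then a r else if p = nx r then b r else 0) * f r
      = d p * f p + a (nx p) * f (nx p) + b (pv p) * f (pv p) := by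
  have hpx : pv p ≠ p := fun h => hn1 p (by have := hnp p; rwa [h] at this)
  have hnpv : nx p ≠ pv p := fun h => hn2 p (by rw [h, hnp])
  have h : ∀ r, (if p = r then d r else if r = nx p then a r else if p = nx r then b r else 0) * f r
      = (if r = p then d r * f r else 0) + (if r = nx p then a r * f r else 0)
        + (if r = pv p then b r * f r else 0) := by
    intro r
    by_cases h1 : r = p
    · rw [h1, if_pos rfl, if_pos rfl, if_neg (hn1 p).symm, if_neg hpx.symm]; ring
    · by_cases h2 : r = nx p
      · have h3 : r ≠ pv p := fun h => hnpv (by rw [← h2, h])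
        rw [if_neg (Ne.symm h1), if_pos h2, if_neg h1, if_pos h2, if_neg h3]; ring
      · by_cases h3 : p = nx r
        · have hr : r = pv p := by rw [h3, hpn]
          rw [if_neg (Ne.symm h1), if_neg h2, if_pos h3, if_neg h1, if_neg h2, if_pos hr]; ring
        · have hr : r ≠ pv p := fun h => h3 (by rw [h, hnp])
          rw [if_neg (Ne.symm h1), if_neg h2, if_neg h3, if_neg h1, if_neg h2, if_neg hr]; ring
  simp only [h, Finset.sum_add_distrib, Finset.sum_ite_eq', Finset.mem_univ, if_true]

/-- **The precision matrix of a cycle**, abstract form: `Σ⁻¹ = (1+T)/(1−T) Γ_B` for any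
successor / predecessor structure `nx`, `pv` on `Fin N` with a single orbit. [folklore] -/
theorem cp_main {N : ℕ} (hN : 0 < N) (nx pv : Fin N → Fin N) (hpn : ∀ i, pv (nx i) = i)
    (hnp : ∀ i, nx (pv i) = i) (hn1 : ∀ i, nx i ≠ i) (hn2 : ∀ i, nx (nx i) ≠ i)
    (horb : ∀ S : Finset (Fin N), (∀ i ∈ S, nx i ∈ S) → S = ∅ ∨ S = Finset.univ)
    (κ : Fin N → ℝ) (hκ : ∀ i, 0 ≤ κ i) (x y : Fin N) :
    (Matrix.of fun p q : Fin N => gksExpect Finset.univ κ (fun i => ({i, nx i} : Finset (Fin N)))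
        (fun ω => spinAt p ω * spinAt q ω))⁻¹ x y
      = (1 + ∏ i, Real.tanh (κ i)) / (1 - ∏ i, Real.tanh (κ i)) *
          (if x = y then 1 + Real.sinh (κ (pv x)) ^ 2 + Real.sinh (κ x) ^ 2
           else if y = nx x then -Real.sinh (2 * κ x) / 2
           else if x = nx y then -Real.sinh (2 * κ y) / 2 else 0) := by
  -- scalars: `Pc = ∏ cosh κ`, `Ps = ∏ sinh κ`, `T = Ps / Pc < 1`
  obtain ⟨Pc, hPc_def⟩ : ∃ Pc : ℝ, Pc = ∏ i, Real.cosh (κ i) := ⟨_, rfl⟩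
  obtain ⟨Ps, hPs_def⟩ : ∃ Ps : ℝ, Ps = ∏ i, Real.sinh (κ i) := ⟨_, rfl⟩
  have hPc : 0 < Pc := hPc_def ▸ Finset.prod_pos fun i _ => Real.cosh_pos _
  have hPs : 0 ≤ Ps := hPs_def ▸ Finset.prod_nonneg fun i _ => Real.sinh_nonneg_iff.2 (hκ i)
  have ht : ∀ i, 0 ≤ Real.tanh (κ i) ∧ Real.tanh (κ i) < 1 := fun i =>
    ⟨by rw [Real.tanh_eq_sinh_div_cosh]
        exact div_nonneg (Real.sinh_nonneg_iff.2 (hκ i)) (Real.cosh_pos _).le, Real.tanh_lt_one _⟩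
  have hT : ∏ i, Real.tanh (κ i) = Ps / Pc := by
    rw [hPs_def, hPc_def]
    simp_rw [Real.tanh_eq_sinh_div_cosh]
    exact Finset.prod_div_distrib _ _
  have hlt : Ps < Pc := by
    rw [← div_lt_one hPc, ← hT, ← Finset.mul_prod_erase _ _ (Finset.mem_univ x)]
    exact lt_of_le_of_lt (mul_le_of_le_one_right (ht x).1
      (Finset.prod_le_one (fun i _ => (ht i).1) fun i _ => (ht i).2.le)) (ht x).2
  have hZ : 0 < Pc + Ps := by linarith
  have hΔ : 0 < Pc - Ps := by linarith
  have hc : (1 + ∏ i, Real.tanh (κ i)) / (1 - ∏ i, Real.tanh (κ i)) = (Pc + Ps) / (Pc - Ps) := by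
    rw [hT, one_add_div hPc.ne', one_sub_div hPc.ne', div_div_div_cancel_right₀ hPc.ne']
  rw [hc]
  -- the matrices `A = Σ`, `B = (1+T)/(1−T) Γ_B`; we show `B * A = 1`
  set A : Matrix (Fin N) (Fin N) ℝ := Matrix.of fun p q : Fin N =>
    gksExpect Finset.univ κ (fun i => ({i, nx i} : Finset (Fin N)))
      (fun ω => spinAt p ω * spinAt q ω) with hA
  obtain ⟨B, hB⟩ : ∃ B : Matrix (Fin N) (Fin N) ℝ, B = Matrix.of fun p q : Fin N =>
    (Pc + Ps) / (Pc - Ps) *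
      (if p = q then 1 + Real.sinh (κ (pv p)) ^ 2 + Real.sinh (κ p) ^ 2
       else if q = nx p then -Real.sinh (2 * κ p) / 2
       else if p = nx q then -Real.sinh (2 * κ q) / 2 else 0) := ⟨_, rfl⟩
  suffices h : B * A = 1 by
    rw [Matrix.inv_eq_left_inv h, hB]
    rfl
  have hsymm : ∀ r s, gksExpect Finset.univ κ (fun i => ({i, nx i} : Finset (Fin N)))
      (fun ω => spinAt r ω * spinAt s ω) = gksExpect Finset.univ κ
        (fun i => ({i, nx i} : Finset (Fin N))) (fun ω => spinAt s ω * spinAt r ω) :=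
    fun r s => congrArg _ (funext fun ω => mul_comm _ _)
  ext p q
  rw [Matrix.mul_apply, Matrix.one_apply]
  have hrow : ∑ r, B p r * A r q = (Pc + Ps) / (Pc - Ps) *
      ((1 + Real.sinh (κ (pv p)) ^ 2 + Real.sinh (κ p) ^ 2) * A p q
        + -Real.sinh (2 * κ p) / 2 * A (nx p) q + -Real.sinh (2 * κ (pv p)) / 2 * A (pv p) q) := by
    simp only [hB, Matrix.of_apply, mul_assoc, ← Finset.mul_sum]
    rw [cp_row_sum nx pv hpn hnp hn1 hn2 p
      (fun _ => 1 + Real.sinh (κ (pv p)) ^ 2 + Real.sinh (κ p) ^ 2)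
      (fun _ => -Real.sinh (2 * κ p) / 2) (fun r => -Real.sinh (2 * κ r) / 2) (fun r => A r q)]
  rw [hrow]
  simp only [hA, Matrix.of_apply]
  by_cases hpq : p = q
  · -- diagonal: `(Γ_B Σ)_{pp} = (1−T)/(1+T)`
    subst hpq
    have hnn : ∀ j, (Pc + Ps) * gksExpect Finset.univ κ (fun i => ({i, nx i} : Finset (Fin N)))
        (fun ω => spinAt j ω * spinAt (nx j) ω) = Real.sinh (κ j) * ∏ i ∈ univ.erase j,
          Real.cosh (κ i) + (∏ i ∈ univ.erase j, Real.sinh (κ i)) * Real.cosh (κ j) := fun j => by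
      rw [cp_nn hN nx pv hpn hn1 horb κ j, hPc_def, hPs_def,
        mul_div_cancel₀ _ (hPc_def ▸ hPs_def ▸ hZ.ne')]
    have hAp := hnn (pv p)
    rw [hnp] at hAp
    have hC : ∀ j, Real.cosh (κ j) * ∏ i ∈ univ.erase j, Real.cosh (κ i) = Pc := fun j =>
      hPc_def ▸ Finset.mul_prod_erase univ (fun i => Real.cosh (κ i)) (Finset.mem_univ j)
    have hS : ∀ j, Real.sinh (κ j) * ∏ i ∈ univ.erase j, Real.sinh (κ i) = Ps := fun j =>
      hPs_def ▸ Finset.mul_prod_erase univ (fun i => Real.sinh (κ i)) (Finset.mem_univ j)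
    rw [if_pos rfl, hsymm (nx p) p, Real.sinh_two_mul, Real.sinh_two_mul, div_mul_eq_mul_div,
      div_eq_one_iff_eq hΔ.ne']
    linear_combination ((Pc + Ps) * (1 + Real.sinh (κ (pv p)) ^ 2 + Real.sinh (κ p) ^ 2))
        * pcm2im_gksExpect_sq κ _ p
      + (-(Real.sinh (κ p) * Real.cosh (κ p))) * hnn p
      + (-(Real.sinh (κ (pv p)) * Real.cosh (κ (pv p)))) * hAp
      + (-Real.sinh (κ p) ^ 2) * hC p + (-Real.cosh (κ p) ^ 2) * hS p
      + (-Real.sinh (κ (pv p)) ^ 2) * hC (pv p) + (-Real.cosh (κ (pv p)) ^ 2) * hS (pv p)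
      + (-Ps) * Real.cosh_sq (κ (pv p)) + (-Ps) * Real.cosh_sq (κ p)
  · -- off-diagonal: the degree-two row
    rw [if_neg hpq, Real.sinh_two_mul, Real.sinh_two_mul]
    linear_combination (Pc + Ps) / (Pc - Ps) * cp_callen nx pv hpn hnp hn1 κ p (spinAt q)
      (fun ω => pcm2im_spinAt_flip_ne (Ne.symm hpq) ω)

/-- Registered stub `helper_cycle_precision` (core D, dividend D2 of line `Sketch`): on the cycle
`Fin N` (`N ≥ 3`, bond `i = {i, i+1 mod N}` with coupling `κ_i ≥ 0`, `T = ∏ tanh κ_i`) the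
precision matrix of the spin second-moment matrix is `Σ⁻¹ = (1+T)/(1−T) Γ_B` with the Bethe
precision `(Γ_B)_{xx} = 1 + sinh²κ_{x−1} + sinh²κ_x`, `(Γ_B)_{x,x+1} = (Γ_B)_{x+1,x} =
−½ sinh 2κ_x`, `0` elsewhere (refines Lauritzen–Uhler–Zwiernik 2021, Prop. 5.3). [folklore] -/
theorem helper_cycle_precision :
    ∀ (N : ℕ) (hN : 3 ≤ N) (κ : Fin N → ℝ), (∀ i, 0 ≤ κ i) →
      ∀ x y : Fin N,
        (Matrix.of fun p q : Fin N => gksExpect Finset.univ κ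
            (fun i : Fin N => ({i, ⟨(i.1 + 1) % N, Nat.mod_lt _ (by omega)⟩} : Finset (Fin N)))
            (fun ω => spinAt p ω * spinAt q ω))⁻¹ x y
          = (1 + ∏ i, Real.tanh (κ i)) / (1 - ∏ i, Real.tanh (κ i)) *
              (if x = y then
                  1 + Real.sinh (κ ⟨(x.1 + N - 1) % N, Nat.mod_lt _ (by omega)⟩) ^ 2 + Real.sinh (κ x) ^ 2
               else if y.1 = (x.1 + 1) % N then -(Real.sinh (2 * κ x)) / 2
               else if x.1 = (y.1 + 1) % N then -(Real.sinh (2 * κ y)) / 2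
               else 0) := by
  intro N hN κ hκ x y
  have h0 : 0 < N := by omega
  refine (cp_main h0 (fun i : Fin N => (⟨(i.1 + 1) % N, Nat.mod_lt _ h0⟩ : Fin N))
    (fun i : Fin N => (⟨(i.1 + N - 1) % N, Nat.mod_lt _ h0⟩ : Fin N)) (cp_idx_pn hN)
    (cp_idx_np hN) (cp_idx_n1 hN) (cp_idx_n2 hN) (cp_idx_orb hN) κ hκ x y).trans ?_
  congr 1
  exact if_congr Iff.rfl rfl (if_congr Fin.ext_iff rfl (if_congr Fin.ext_iff rfl rfl))

end Summit.CriticalPhenomena.Ising3DConformalLimit.Cruxes.InverseMFerromagnet.PartialCovarianceLadder
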